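import Summits.CriticalPhenomena.PercolationContinuityZ3.Theorems.PercNearOneGluingNoHeavyLowerTailTwoPortPeelingTools
import HarnessLib

/-!
# `NoHeavyLowerTail` (stmt-CriticalPhenomena-4575) — two-port peeling: the three slice facts

Route `PercNearOneGluingNoHeavy`, seat `prim-gen-swap` (gen 5); memo TWO-PORT-PEELING.md §1.  Setting of `…TwoPortPeeling.lean`: `v ∉ A` a two-port
star with ports `b ≠ b'`, `θ = w s(v,b)·w s(v,b')`, `u` any vertex, `c ∈ A` a champion of `w`; `w₀₀, w₁₀, w₀₁, w₁₁` = `w` with the two port pairs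
pinned; `Ψ_{w'} = μ_{w'}(ρ) − μ_{w'}(ℓ)` for the CS₂ pair events `ℓ = {c ↮ u, c ↮ v, 1 ≤ |π(u) ∪ π(v)| ≤ j}`, `ρ = {c ↮ u, c ↮ v, |π(c)| ≤ j}`.
* `TwoPortPeeling.slice_empty_lb`     : `Ψ_{w₀₀} ≥ μ_{w₀₀}(R_c) − μ_{w₀₀}(1 ≤ |π(u)| ≤ j)` (in `w₀₀` the star is deleted and `v` is a.s. isolated);
* `TwoPortPeeling.mixed_hubMove`      : `(1 − θ)Ψ_{w₁₀} + θΨ_{w₁₁} ≥ 0` — hub-move in the weights `v–b ↦ 1, v–b' ↦ θ`, which have the relay law of `w`;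
* `TwoPortPeeling.theta_glued_nonneg` : `θ·Ψ_{w₁₁} ≥ 0`.
BHK enters only through `Literature…twoObserver_le_of_lonelier`.  No definitions, no named facts, no sorries.
-/

noncomputable section

namespace Summit.CriticalPhenomena.PercolationContinuityZ3.Theorems

open MeasureTheory Set Literature.Probability.LatticeModels Literature.Probability.Percolation
open scoped Classical BigOperators

variable {n : ℕ}

namespace TwoPortPeeling

/-- **The empty slice versus the single observer.**  In the deleted graph `w₀₀` (every pair at `v` of weight `0`) `v` is almost
surely isolated, so `Ψ_{w₀₀} ≥ μ_{w₀₀}(R_c) − μ_{w₀₀}(1 ≤ |π(u)| ≤ j)`. [this file; as in `StarPair.slice_empty`] -/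
theorem slice_empty_lb (w₀ : Sym2 (Fin n) → unitInterval) (A : Finset (Fin n)) (u v c : Fin n) (j : ℕ)
    (hv : v ∉ A) (hc : c ∈ A) (h0 : ∀ y : Fin n, y ≠ v → w₀ s(v, y) = 0) :
    (prodBernoulli w₀).real {ω : BondConfig (Fin n) | (A.filter fun z => ω ∈ openConn c z).card ≤ j} -
        (prodBernoulli w₀).real {ω : BondConfig (Fin n) |
          1 ≤ (A.filter fun z => ω ∈ openConn u z).card ∧ (A.filter fun z => ω ∈ openConn u z).card ≤ j} ≤
      (prodBernoulli w₀).real {ω : BondConfig (Fin n) | ω ∉ openConn c u ∧ ω ∉ openConn c v ∧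
          (A.filter fun z => ω ∈ openConn c z).card ≤ j} -
        (prodBernoulli w₀).real {ω : BondConfig (Fin n) | ω ∉ openConn c u ∧ ω ∉ openConn c v ∧
          1 ≤ (A.filter fun z => ω ∈ openConn u z ∨ ω ∈ openConn v z).card ∧
          (A.filter fun z => ω ∈ openConn u z ∨ ω ∈ openConn v z).card ≤ j} := by
  set μ := prodBernoulli w₀ with hμ
  have hmeas : ∀ S : Set (BondConfig (Fin n)), MeasurableSet S := fun _ => MeasurableSet.of_discrete
  set F : Finset (Sym2 (Fin n)) := (Finset.univ.filter fun y : Fin n => y ≠ v).image (fun y => s(v, y)) with hF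
  set Z : Set (BondConfig (Fin n)) := {ω | ∃ e ∈ F, e ∈ ω} with hZ
  have hF0 : ∀ e ∈ F, (w₀ e : ℝ) = 0 := by
    intro e he
    obtain ⟨y, hy, rfl⟩ := Finset.mem_image.1 he
    have hyv : y ≠ v := (Finset.mem_filter.1 hy).2
    simp [h0 y hyv]
  have hZ0 : μ.real Z = 0 := by
    rw [measureReal_def, hμ, prodBernoulli_setOf_exists_mem_eq_zero w₀ F hF0, ENNReal.toReal_zero]
  have hiso : ∀ ω : BondConfig (Fin n), ω ∉ Z → ∀ x : Fin n, x ≠ v → ¬ (openGraph ω).Reachable v x := by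
    intro ω hω x hxv
    rintro ⟨p⟩
    cases p with
    | nil => exact hxv rfl
    | cons hadj _ =>
      rw [openGraph_adj] at hadj
      refine hω ⟨s(v, _), Finset.mem_image.2 ⟨_, Finset.mem_filter.2 ⟨Finset.mem_univ _, fun h => hadj.2 h.symm⟩, rfl⟩, hadj.1⟩
  have hcv : c ≠ v := fun h => hv (h ▸ hc)
  set C : Set (BondConfig (Fin n)) := openConn c u with hC
  set Au : Set (BondConfig (Fin n)) := {ω | 1 ≤ (A.filter fun x => ω ∈ openConn u x).card ∧
      (A.filter fun x => ω ∈ openConn u x).card ≤ j} with hAu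
  set Rc : Set (BondConfig (Fin n)) := {ω | (A.filter fun x => ω ∈ openConn c x).card ≤ j} with hRc
  have hL : {ω : BondConfig (Fin n) | ω ∉ openConn c u ∧ ω ∉ openConn c v ∧
        1 ≤ (A.filter fun z => ω ∈ openConn u z ∨ ω ∈ openConn v z).card ∧
        (A.filter fun z => ω ∈ openConn u z ∨ ω ∈ openConn v z).card ≤ j} ⊆ (Au \ C) ∪ Z := by
    intro ω hω
    by_cases hωZ : ω ∈ Z
    · exact Or.inr hωZ
    · obtain ⟨hcu, -, h1, h2⟩ := hω
      have hfilt : (A.filter fun z => ω ∈ openConn u z ∨ ω ∈ openConn v z) =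
          (A.filter fun z => ω ∈ openConn u z) := by
        refine Finset.filter_congr fun z hz => ⟨fun h => h.elim id fun hvz => ?_, fun h => Or.inl h⟩
        exact absurd hvz (hiso ω hωZ z (fun hzv => hv (hzv ▸ hz)))
      rw [hfilt] at h1 h2
      exact Or.inl ⟨⟨h1, h2⟩, hcu⟩
  have hR : (Rc \ C) \ Z ⊆ {ω : BondConfig (Fin n) | ω ∉ openConn c u ∧ ω ∉ openConn c v ∧
        (A.filter fun z => ω ∈ openConn c z).card ≤ j} := by
    rintro ω ⟨⟨hRc', hcu⟩, hωZ⟩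
    refine ⟨hcu, fun hcv' => ?_, hRc'⟩
    have : (openGraph ω).Reachable v c := (hcv' : (openGraph ω).Reachable c v).symm
    exact hiso ω hωZ c hcv this
  have hAC : Au ∩ C = Rc ∩ C := by
    ext ω
    simp only [hAu, hRc, hC, mem_inter_iff, mem_setOf_eq]
    constructor
    · rintro ⟨⟨-, h2⟩, hcu⟩
      have hcu' : (openGraph ω).Reachable c u := hcu
      have heq : (A.filter fun x => ω ∈ openConn c x) = (A.filter fun x => ω ∈ openConn u x) :=
        Finset.filter_congr fun x _ => ⟨fun h => hcu'.symm.trans h, fun h => hcu'.trans h⟩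
      rw [heq]; exact ⟨h2, hcu⟩
    · rintro ⟨h2, hcu⟩
      have hcu' : (openGraph ω).Reachable c u := hcu
      have heq : (A.filter fun x => ω ∈ openConn u x) = (A.filter fun x => ω ∈ openConn c x) :=
        Finset.filter_congr fun x _ => ⟨fun h => hcu'.trans h, fun h => hcu'.symm.trans h⟩
      rw [heq]
      exact ⟨⟨Finset.card_pos.2 ⟨c, Finset.mem_filter.2 ⟨hc, SimpleGraph.Reachable.refl c⟩⟩, h2⟩, hcu⟩
  have hsA : μ.real Au = μ.real (Au ∩ C) + μ.real (Au \ C) :=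
    (measureReal_inter_add_sdiff (μ := μ) (s := Au) (hmeas C)).symm
  have hsR : μ.real Rc = μ.real (Rc ∩ C) + μ.real (Rc \ C) :=
    (measureReal_inter_add_sdiff (μ := μ) (s := Rc) (hmeas C)).symm
  have h1 : μ.real {ω : BondConfig (Fin n) | ω ∉ openConn c u ∧ ω ∉ openConn c v ∧
        1 ≤ (A.filter fun z => ω ∈ openConn u z ∨ ω ∈ openConn v z).card ∧
        (A.filter fun z => ω ∈ openConn u z ∨ ω ∈ openConn v z).card ≤ j} ≤ μ.real (Au \ C) := by
    refine (measureReal_mono hL).trans ?_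
    refine (measureReal_union_le _ _).trans ?_
    simp only [hZ0, add_zero, le_refl]
  have h2 : μ.real (Rc \ C) ≤ μ.real {ω : BondConfig (Fin n) | ω ∉ openConn c u ∧ ω ∉ openConn c v ∧
        (A.filter fun z => ω ∈ openConn c z).card ≤ j} := by
    have hsplit : μ.real (Rc \ C) = μ.real ((Rc \ C) ∩ Z) + μ.real ((Rc \ C) \ Z) :=
      (measureReal_inter_add_sdiff (μ := μ) (s := Rc \ C) (hmeas Z)).symm
    have hz : μ.real ((Rc \ C) ∩ Z) = 0 :=
      le_antisymm ((measureReal_mono inter_subset_right).trans hZ0.le) measureReal_nonneg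
    rw [hsplit, hz, zero_add]
    exact measureReal_mono hR
  rw [hAC] at hsA
  linarith


/-- **Mixed hub-move (FACT 1).**  `v ∉ A` a two-port star with ports `b ≠ b'`, `θ = w s(v,b) · w s(v,b')`, `c ∈ A` a champion
of `w`, `u` any vertex: `(1 − θ)·Ψ_{w₁₀} + θ·Ψ_{w₁₁} ≥ 0`.  Proof: the weights `w^θ = w[s(v,b)↦1][s(v,b')↦θ]` have the relay law
of `w` (`relay_law_eq` for both), so `c` is a champion of `w^θ` and `μ_{w^θ}(R_v) = μ_{w^θ}(R_b) ≤ μ_{w^θ}(R_c)`; hub-move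
(`Literature…twoObserver_le_of_lonelier`) in `w^θ`, then the one-bond decomposition at `s(v,b')`.
[cite: VandenbergHaggstromKahn2005, Thm. 1.5 (p. 7) — via the Literature lemma named] -/
theorem mixed_hubMove (w : Sym2 (Fin n) → unitInterval) (A : Finset (Fin n)) (u v b b' c : Fin n) (j : ℕ)
    (hv : v ∉ A) (hb : b ∈ A) (hb' : b' ∈ A) (hbb' : b ≠ b') (hc : c ∈ A)
    (hvtwo : ∀ y : Fin n, y ≠ v → y ≠ b → y ≠ b' → w s(v, y) = 0)
    (hchamp : ∀ a ∈ A,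
      (prodBernoulli w).real {ω : BondConfig (Fin n) | (A.filter fun x => ω ∈ openConn a x).card ≤ j} ≤
        (prodBernoulli w).real {ω : BondConfig (Fin n) | (A.filter fun x => ω ∈ openConn c x).card ≤ j}) :
    0 ≤ (1 - (w s(v, b) : ℝ) * w s(v, b')) *
        ((prodBernoulli (Function.update (Function.update w s(v, b) 1) s(v, b') 0)).real
            {ω : BondConfig (Fin n) | ω ∉ openConn c u ∧ ω ∉ openConn c v ∧
              (A.filter fun z => ω ∈ openConn c z).card ≤ j} -
          (prodBernoulli (Function.update (Function.update w s(v, b) 1) s(v, b') 0)).real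
            {ω : BondConfig (Fin n) | ω ∉ openConn c u ∧ ω ∉ openConn c v ∧
              1 ≤ (A.filter fun z => ω ∈ openConn u z ∨ ω ∈ openConn v z).card ∧
              (A.filter fun z => ω ∈ openConn u z ∨ ω ∈ openConn v z).card ≤ j}) +
      ((w s(v, b) : ℝ) * w s(v, b')) *
        ((prodBernoulli (Function.update (Function.update w s(v, b) 1) s(v, b') 1)).real
            {ω : BondConfig (Fin n) | ω ∉ openConn c u ∧ ω ∉ openConn c v ∧
              (A.filter fun z => ω ∈ openConn c z).card ≤ j} -
          (prodBernoulli (Function.update (Function.update w s(v, b) 1) s(v, b') 1)).real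
            {ω : BondConfig (Fin n) | ω ∉ openConn c u ∧ ω ∉ openConn c v ∧
              1 ≤ (A.filter fun z => ω ∈ openConn u z ∨ ω ∈ openConn v z).card ∧
              (A.filter fun z => ω ∈ openConn u z ∨ ω ∈ openConn v z).card ≤ j}) := by
  have hbv : b ≠ v := fun h => hv (h ▸ hb)
  have hb'v : b' ≠ v := fun h => hv (h ▸ hb')
  have hcv : c ≠ v := fun h => hv (h ▸ hc)
  have hee := port_ne hbb' hbv
  set e : Sym2 (Fin n) := s(v, b) with he
  set e' : Sym2 (Fin n) := s(v, b') with he'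
  set θI : unitInterval := ⟨(w e : ℝ) * w e', unitInterval.mul_mem (w e).2 (w e').2⟩ with hθI
  set w10 := Function.update (Function.update w e 1) e' 0 with hw10
  set w11 := Function.update (Function.update w e 1) e' 1 with hw11
  set wθ := Function.update (Function.update w e 1) e' θI with hwθ
  let R : Fin n → Set (BondConfig (Fin n)) := fun x => {ω | (A.filter fun z => ω ∈ openConn x z).card ≤ j}
  -- one-bond decomposition of `wθ` at `e'`
  have hdecθ : ∀ S : Set (BondConfig (Fin n)), (prodBernoulli wθ).real S =
      (1 - (w e : ℝ) * w e') * (prodBernoulli w10).real S + (w e : ℝ) * w e' * (prodBernoulli w11).real S := by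
    intro S
    rw [stub_oneBondDecomp_k15 n wθ e' S]
    have h1 : (wθ e' : ℝ) = (w e : ℝ) * w e' := by rw [hwθ, Function.update_self]
    have h2 : Function.update wθ e' 0 = w10 := by rw [hwθ, Function.update_idem]
    have h3 : Function.update wθ e' 1 = w11 := by rw [hwθ, Function.update_idem]
    rw [h1, h2, h3]
  -- relay laws of `wθ` and `w` coincide
  have hrelay : ∀ x : Fin n, x ≠ v → (prodBernoulli wθ).real (R x) = (prodBernoulli w).real (R x) := by
    intro x hxv
    rw [hdecθ, relay_law_eq w A x j hv hbb' hbv hb'v hxv hvtwo, hw10, update_one_zero_eq w hee]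
    rw [pendant_real_relay_eq _ A v b x j hv hbv hxv (deleted_zero_at w hbb' hbv hvtwo)]
  have hchampθ : ∀ a ∈ A, (prodBernoulli wθ).real (R a) ≤ (prodBernoulli wθ).real (R c) := by
    intro a ha
    have hav : a ≠ v := fun h => hv (h ▸ ha)
    rw [hrelay a hav, hrelay c hcv]
    exact hchamp a ha
  -- `μ_{wθ}(R_v) = μ_{wθ}(R_b) ≤ μ_{wθ}(R_c)`
  have hle : (prodBernoulli wθ).real (R v) ≤ (prodBernoulli wθ).real (R c) := by
    have : (prodBernoulli wθ).real (R v) = (prodBernoulli wθ).real (R b) := by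
      rw [hdecθ, hdecθ]
      show (1 - (w e : ℝ) * w e') * (prodBernoulli w10).real (R v) + (w e : ℝ) * w e' * (prodBernoulli w11).real (R v) =
        (1 - (w e : ℝ) * w e') * (prodBernoulli w10).real (R b) + (w e : ℝ) * w e' * (prodBernoulli w11).real (R b)
      rw [hw10, hw11, glued10_real_eq w A j hb hbb' hbv hvtwo, glued11_real_eq w A j hb hbb' hbv]
    rw [this]
    exact hchampθ b hb
  have key := twoObserver_le_of_lonelier wθ A u v c j hle
  rw [hdecθ, hdecθ] at key
  linarith

/-- **FACT 2: the doubly glued slice is good, `θ·Ψ_{w₁₁} ≥ 0`.**  Either `c` beats `b` in the deleted graph `w₀₀` — then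
`μ_{w₁₁}(R_v) ≤ μ_{w₁₁}(R_c)` by two gluings (`glue_pair_identity` + `twoObserver_le_of_lonelier` each) — or it does not, and then the
champion inequality `μ_w(R_b) ≤ μ_w(R_c)` in the form `relay_law_eq` forces `θ(μ_{w₁₁}(R_c) − μ_{w₁₁}(R_v)) > 0`; either way
`Literature…twoObserver_le_of_lonelier` applies in `w₁₁` (when `θ > 0`).
[cite: VandenbergHaggstromKahn2005, Thm. 1.5 (p. 7) — via the Literature lemma named] -/
theorem theta_glued_nonneg (w : Sym2 (Fin n) → unitInterval) (A : Finset (Fin n)) (u v b b' c : Fin n) (j : ℕ)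
    (hv : v ∉ A) (hb : b ∈ A) (hb' : b' ∈ A) (hbb' : b ≠ b') (hc : c ∈ A)
    (hvtwo : ∀ y : Fin n, y ≠ v → y ≠ b → y ≠ b' → w s(v, y) = 0)
    (hchamp : ∀ a ∈ A,
      (prodBernoulli w).real {ω : BondConfig (Fin n) | (A.filter fun x => ω ∈ openConn a x).card ≤ j} ≤
        (prodBernoulli w).real {ω : BondConfig (Fin n) | (A.filter fun x => ω ∈ openConn c x).card ≤ j}) :
    0 ≤ ((w s(v, b) : ℝ) * w s(v, b')) *
        ((prodBernoulli (Function.update (Function.update w s(v, b) 1) s(v, b') 1)).real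
            {ω : BondConfig (Fin n) | ω ∉ openConn c u ∧ ω ∉ openConn c v ∧
              (A.filter fun z => ω ∈ openConn c z).card ≤ j} -
          (prodBernoulli (Function.update (Function.update w s(v, b) 1) s(v, b') 1)).real
            {ω : BondConfig (Fin n) | ω ∉ openConn c u ∧ ω ∉ openConn c v ∧
              1 ≤ (A.filter fun z => ω ∈ openConn u z ∨ ω ∈ openConn v z).card ∧
              (A.filter fun z => ω ∈ openConn u z ∨ ω ∈ openConn v z).card ≤ j}) := by
  have hbv : b ≠ v := fun h => hv (h ▸ hb)
  have hb'v : b' ≠ v := fun h => hv (h ▸ hb')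
  have hcv : c ≠ v := fun h => hv (h ▸ hc)
  have hee := port_ne hbb' hbv
  set e : Sym2 (Fin n) := s(v, b) with he
  set e' : Sym2 (Fin n) := s(v, b') with he'
  set w00 := Function.update (Function.update w e 0) e' 0 with hw00
  set w10 := Function.update (Function.update w e 1) e' 0 with hw10
  set w11 := Function.update (Function.update w e 1) e' 1 with hw11
  let R : Fin n → Set (BondConfig (Fin n)) := fun x => {ω | (A.filter fun z => ω ∈ openConn x z).card ≤ j}
  have hβ0 : 0 ≤ (w e : ℝ) := (w e).2.1
  have hβ1 : (w e : ℝ) ≤ 1 := (w e).2.2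
  have hβ'0 : 0 ≤ (w e' : ℝ) := (w e').2.1
  have hβ'1 : (w e' : ℝ) ≤ 1 := (w e').2.2
  have h00 := deleted_zero_at w hbb' hbv hvtwo
  have hw10' : w10 = Function.update w00 e 1 := by rw [hw10, hw00]; exact update_one_zero_eq w hee
  have h11 : w11 = Function.update w10 e' 1 := by rw [hw11, hw10]; exact update_one_one_eq' w e e'
  have h10e' : w10 e' = 0 := by rw [hw10, Function.update_self]
  -- the comparison `μ_{w11}(R_v) ≤ μ_{w11}(R_c)` whenever `θ > 0`
  have hmain : 0 < (w e : ℝ) * w e' → (prodBernoulli w11).real (R v) ≤ (prodBernoulli w11).real (R c) := by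
    intro hθpos
    by_cases hcase : (prodBernoulli w00).real (R b) ≤ (prodBernoulli w00).real (R c)
    · -- hub-move twice, each time as `glue_pair_identity` + `twoObserver_le_of_lonelier`
      have h1 : (prodBernoulli w10).real (R v) ≤ (prodBernoulli w10).real (R c) := by
        have hg : (prodBernoulli w10).real (R v) = (prodBernoulli w10).real
            {ω : BondConfig (Fin n) | 1 ≤ (A.filter fun z => ω ∈ openConn v z).card ∧
              (A.filter fun z => ω ∈ openConn v z).card ≤ j} := by
          rw [hw10, glued10_real_eq w A j hb hbb' hbv hvtwo, relay_lonely_eq_small A b j hb, update_one_zero_eq w hee]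
          exact (glued_real_count_eq _ A v b (fun m => 1 ≤ m ∧ m ≤ j) hbv (h00 b hbv)).symm
        have hid := glue_pair_identity w00 A v b c j hbv hc (h00 b hbv)
        have htwo := twoObserver_le_of_lonelier w00 A v b c j hcase
        rw [hg, hw10']
        linarith
      -- second gluing: `v` into `b'`, pairwise hypothesis on `v`'s side
      have hvb' : v ≠ b' := fun h => hb'v h.symm
      have hsw : (s(b', v) : Sym2 (Fin n)) = e' := Sym2.eq_swap
      have h10e'' : w10 s(b', v) = 0 := by rw [hsw]; exact h10e'
      have hid2 := glue_pair_identity w10 A b' v c j hvb' hc h10e''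
      have htwo2 := twoObserver_le_of_lonelier w10 A b' v c j h1
      rw [hsw, ← h11, ← relay_lonely_eq_small A b' j hb'] at hid2
      have hg' : (prodBernoulli w11).real (R v) = (prodBernoulli w11).real (R b') := by
        rw [h11]; exact glued_real_lonely_eq w10 A v b' j hb'v hb' h10e'
      show (prodBernoulli w11).real (R v) ≤ (prodBernoulli w11).real (R c)
      rw [hg']
      linarith
    · -- the champion inequality for `b`, via the relay law
      have hcase' := not_le.1 hcase
      have hKb := hchamp b hb
      change (prodBernoulli w).real (R b) ≤ (prodBernoulli w).real (R c) at hKb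
      rw [relay_law_eq w A b j hv hbb' hbv hb'v hbv hvtwo, relay_law_eq w A c j hv hbb' hbv hb'v hcv hvtwo] at hKb
      have hg : (prodBernoulli w11).real (R v) = (prodBernoulli w11).real (R b) := by
        rw [hw11]; exact glued11_real_eq w A j hb hbb' hbv
      rw [hg]
      by_contra hlt
      have hlt' := not_le.1 hlt
      have h1θ : 0 ≤ 1 - (w e : ℝ) * w e' := by nlinarith
      nlinarith [mul_nonneg h1θ (le_of_lt (sub_pos.2 hcase')), mul_pos hθpos (sub_pos.2 hlt')]
  rcases (mul_nonneg hβ0 hβ'0).eq_or_lt with hθ0 | hθpos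
  · rw [← hθ0]; simp
  · exact mul_nonneg (le_of_lt hθpos) (sub_nonneg.2 (twoObserver_le_of_lonelier w11 A u v c j (hmain hθpos)))

end TwoPortPeeling

end Summit.CriticalPhenomena.PercolationContinuityZ3.Theorems

end
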